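import Mathlib
import Literature.Analysis.Asymptotics.LogarithmicSummabilityTauberian
import HarnessLib

/-!
# Móricz 2013, Corollary 1 (the function case) — proof

Discharge of the named fact `Literature.Analysis.Asymptotics.Moricz2013_corollary1`
(`LogarithmicSummabilityTauberian.lean`): a real function `s`, integrable on every `[1, t]`,
slowly decreasing with respect to logarithmic summability `(L, 1)` and summable `(L, 1)` to `A`,
converges to `A`.

We follow the printed proof (F. Móricz, Studia Math. 219 (2013), arXiv:1206.6188, §3: Theorem 1
via Lemma 1; Corollary 1 is its immediate consequence).  With `J(a, b) = ∫_a^b s(u)/u du`,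
`τ(t) = J(1, t)/log t`, Lemma 1 (i) reads
`s(t) (λ - 1) log t = (τ(t^λ) - τ(t)) λ log t + τ(t) (λ - 1) log t - ∫_t^{t^λ} (s(u) - s(t))/u du`,
slow decrease bounds the last integral below by `-ε (λ - 1) log t`, whence
`s(t) ≤ τ(t) + ε + |τ(t^λ) - τ(t)| λ/(λ - 1)` for large `t`; Lemma 1 (ii) with `t^{1/λ}` gives
the matching lower bound.  Below this is rendered in `ε`–`N` form.

## References
* [Moricz2013] F. Móricz, *Necessary and sufficient Tauberian conditions for the logarithmic
  summability of functions and sequences*, Studia Math. 219 (2013) 109–121, arXiv:1206.6188,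
  §3 Lemma 1 and Theorem 1, Corollary 1 (p. 2).
-/

namespace Literature.Analysis.Asymptotics

open _root_.Filter _root_.MeasureTheory _root_.Set intervalIntegral
open scoped _root_.Topology

section Moricz2013Cor1Proof

/-- `u ↦ c / u` is interval integrable on `[a, b] ⊆ [1, ∞)`. [folklore] -/
private theorem Moricz2013I.intervalIntegrable_const_div (c : ℝ) {a b : ℝ} (ha : 1 ≤ a)
    (hab : a ≤ b) : IntervalIntegrable (fun u : ℝ => c / u) volume a b := by
  refine (continuousOn_const.div continuousOn_id fun x hx => ?_).intervalIntegrable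
  rw [uIcc_of_le hab] at hx
  exact (lt_of_lt_of_le one_pos (ha.trans hx.1)).ne'

/-- `∫_a^b c/u du = c (log b - log a)` on `[1, ∞)`. [folklore] -/
private theorem Moricz2013I.integral_const_div (c : ℝ) {a b : ℝ} (ha : 1 ≤ a) (hab : a ≤ b) :
    ∫ u in a..b, c / u = c * (Real.log b - Real.log a) := by
  have h0 : (0 : ℝ) ∉ uIcc a b := by
    rw [uIcc_of_le hab]
    intro h
    exact absurd (ha.trans h.1) (by norm_num)
  simp_rw [div_eq_mul_inv]
  rw [intervalIntegral.integral_const_mul, integral_inv h0,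
    Real.log_div (by linarith) (by linarith)]

/-- `u ↦ s(u)/u` is interval integrable on `[a, b] ⊆ [1, ∞)` when `s` is on every `[1, t]`.
[folklore] -/
private theorem Moricz2013I.intervalIntegrable_div (s : ℝ → ℝ)
    (hint : ∀ t : ℝ, 1 ≤ t → IntervalIntegrable s volume 1 t) {a b : ℝ} (ha : 1 ≤ a)
    (hab : a ≤ b) : IntervalIntegrable (fun u : ℝ => s u / u) volume a b := by
  have h1 : IntervalIntegrable s volume a b := by
    refine (hint b (ha.trans hab)).mono_set ?_
    rw [uIcc_of_le hab, uIcc_of_le (ha.trans hab)]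
    exact Icc_subset_Icc ha le_rfl
  have h2 : ContinuousOn (fun u : ℝ => u⁻¹) (uIcc a b) := by
    refine continuousOn_inv₀.mono fun x hx => ?_
    rw [uIcc_of_le hab] at hx
    exact (lt_of_lt_of_le one_pos (ha.trans hx.1)).ne'
  simpa [div_eq_mul_inv] using h1.mul_continuousOn h2

/-- Slow decrease integrated (upper form): if `-ε ≤ s(u) - c` on `[a, b] ⊆ [1, ∞)`, then
`c (log b - log a) ≤ ∫_a^b s(u)/u du + ε (log b - log a)`. [cite: Moricz2013, Lemma 1 (i)] -/
private theorem Moricz2013I.le_integral (s : ℝ → ℝ)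
    (hint : ∀ t : ℝ, 1 ≤ t → IntervalIntegrable s volume 1 t) (c ε : ℝ) {a b : ℝ} (ha : 1 ≤ a)
    (hab : a ≤ b) (h : ∀ u ∈ Icc a b, -ε ≤ s u - c) :
    c * (Real.log b - Real.log a) ≤ (∫ u in a..b, s u / u) + ε * (Real.log b - Real.log a) := by
  have hmono : (∫ u in a..b, (c - ε) / u) ≤ ∫ u in a..b, s u / u := by
    refine intervalIntegral.integral_mono_on hab
      (Moricz2013I.intervalIntegrable_const_div _ ha hab)
      (Moricz2013I.intervalIntegrable_div s hint ha hab) fun u hu => ?_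
    have hu0 : 0 < u := lt_of_lt_of_le one_pos (ha.trans hu.1)
    exact div_le_div_of_nonneg_right (by linarith [h u hu]) hu0.le
  rw [Moricz2013I.integral_const_div _ ha hab] at hmono
  linarith

/-- Slow decrease integrated (lower form): if `-ε ≤ c - s(u)` on `[a, b] ⊆ [1, ∞)`, then
`∫_a^b s(u)/u du - ε (log b - log a) ≤ c (log b - log a)`. [cite: Moricz2013, Lemma 1 (ii)] -/
private theorem Moricz2013I.integral_le (s : ℝ → ℝ)
    (hint : ∀ t : ℝ, 1 ≤ t → IntervalIntegrable s volume 1 t) (c ε : ℝ) {a b : ℝ} (ha : 1 ≤ a)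
    (hab : a ≤ b) (h : ∀ u ∈ Icc a b, -ε ≤ c - s u) :
    (∫ u in a..b, s u / u) - ε * (Real.log b - Real.log a) ≤ c * (Real.log b - Real.log a) := by
  have hmono : (∫ u in a..b, s u / u) ≤ ∫ u in a..b, (c + ε) / u := by
    refine intervalIntegral.integral_mono_on hab
      (Moricz2013I.intervalIntegrable_div s hint ha hab)
      (Moricz2013I.intervalIntegrable_const_div _ ha hab) fun u hu => ?_
    have hu0 : 0 < u := lt_of_lt_of_le one_pos (ha.trans hu.1)
    exact div_le_div_of_nonneg_right (by linarith [h u hu]) hu0.le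
  rw [Moricz2013I.integral_const_div _ ha hab] at hmono
  linarith

/-- Additivity `J(1, b) - J(1, a) = J(a, b)` for `1 ≤ a ≤ b`. [folklore] -/
private theorem Moricz2013I.integral_sub_integral (s : ℝ → ℝ)
    (hint : ∀ t : ℝ, 1 ≤ t → IntervalIntegrable s volume 1 t) {a b : ℝ} (ha : 1 ≤ a)
    (hab : a ≤ b) :
    (∫ u in (1 : ℝ)..b, s u / u) - ∫ u in (1 : ℝ)..a, s u / u = ∫ u in a..b, s u / u := by
  have := intervalIntegral.integral_add_adjacent_intervals
    (Moricz2013I.intervalIntegrable_div s hint le_rfl ha)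
    (Moricz2013I.intervalIntegrable_div s hint ha hab)
  linarith

/-- **Móricz 2013, Corollary 1 — proved** (discharge of `Moricz2013_corollary1`): for a real
function integrable on every `[1, t]`, slow decrease with respect to `(L, 1)` plus
`(L, 1)`-summability to `A` imply `s(t) → A`.  Printed proof: Theorem 1 via Lemma 1.
[cite: Moricz2013, Cor. 1 with (∗), (2.3); §3 Lemma 1 and Theorem 1] -/
theorem Moricz2013_corollary1_holds : Moricz2013_corollary1 := by
  intro s A hint hsd hτ
  -- `J x = ∫_1^x s(u)/u du`, `τ x = J x / log x`
  obtain ⟨J, hJ⟩ : ∃ J : ℝ → ℝ, ∀ x, J x = ∫ u in (1 : ℝ)..x, s u / u := ⟨_, fun _ => rfl⟩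
  obtain ⟨τ, hτdef⟩ : ∃ τ : ℝ → ℝ, ∀ x, τ x = J x / Real.log x := ⟨_, fun _ => rfl⟩
  have hτ' : Tendsto τ atTop (𝓝 A) := by
    have e : τ = fun t : ℝ => (∫ u in (1 : ℝ)..t, s u / u) / Real.log t :=
      funext fun t => by rw [hτdef, hJ]
    rw [e]
    exact hτ
  have hJτ : ∀ x : ℝ, 1 < x → J x = τ x * Real.log x := fun x hx => by
    rw [hτdef, div_mul_cancel₀ _ (Real.log_pos hx).ne']
  -- ε–N
  rw [Metric.tendsto_atTop]
  intro ε hε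
  set ε' : ℝ := ε / 4 with hε'
  have hε'pos : 0 < ε' := by positivity
  obtain ⟨t₀, l, ht₀, hl, hslow⟩ := hsd ε' hε'pos
  have hl0 : 0 < l := by linarith
  have hlm1 : 0 < l - 1 := by linarith
  have hlne : l ≠ 0 := hl0.ne'
  set K : ℝ := l / (l - 1) with hK
  have hKpos : 0 < K := by positivity
  set δ : ℝ := ε' / (2 * K + 1) with hδ
  have hδpos : 0 < δ := by positivity
  have hδK : δ * (2 * K + 1) = ε' := by rw [hδ, div_mul_cancel₀ _ (by positivity)]
  obtain ⟨Tτ, hTτ⟩ := (Metric.tendsto_atTop.1 hτ') δ hδpos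
  have hτA : ∀ x, Tτ ≤ x → |τ x - A| < δ := fun x hx => by
    have := hTτ x hx; rwa [Real.dist_eq] at this
  -- threshold `N = M ^ l` with `M = max (max t₀ Tτ) 2`
  set M : ℝ := max (max t₀ Tτ) 2 with hM
  have hM2 : 2 ≤ M := le_max_right _ _
  have hMt₀ : t₀ ≤ M := (le_max_left _ _).trans (le_max_left _ _)
  have hMτ : Tτ ≤ M := (le_max_right _ _).trans (le_max_left _ _)
  have hM1 : 1 ≤ M := by linarith
  have hM0 : 0 ≤ M := by linarith
  refine ⟨M ^ l, fun t ht => ?_⟩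
  have hMMl : M ≤ M ^ l := by
    have := Real.rpow_le_rpow_of_exponent_le hM1 hl.le
    rwa [Real.rpow_one] at this
  have htM : M ≤ t := hMMl.trans ht
  have ht2 : 2 ≤ t := hM2.trans htM
  have ht1 : 1 < t := by linarith
  have htpos : 0 < t := by linarith
  have ht₀t : t₀ ≤ t := hMt₀.trans htM
  have hτt : Tτ ≤ t := hMτ.trans htM
  set Lt : ℝ := Real.log t with hLt
  have hLtpos : 0 < Lt := Real.log_pos ht1
  have hJt : J t = τ t * Lt := hJτ t ht1
  ------------------------------------------------------------------
  -- UPPER BOUND via `T = t ^ l`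
  ------------------------------------------------------------------
  have hup : s t < A + 2 * ε' := by
    set T : ℝ := t ^ l with hT
    have htT : t < T := by
      have := Real.rpow_lt_rpow_of_exponent_lt ht1 hl
      rwa [Real.rpow_one] at this
    have hT1 : 1 < T := ht1.trans htT
    have hlogT : Real.log T = l * Lt := by rw [hT, Real.log_rpow htpos]
    have hJT : J T = τ T * (l * Lt) := by rw [hJτ T hT1, hlogT]
    -- slow decrease on `[t, T]`
    have hsd' : ∀ u ∈ Icc t T, -ε' ≤ s u - s t := by
      intro u hu
      rcases eq_or_lt_of_le hu.1 with h | h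
      · rw [← h]; simp [hε'pos.le]
      · exact hslow t u ht₀t h hu.2
    have h1 := Moricz2013I.le_integral s hint (s t) ε' ht1.le htT.le hsd'
    rw [← Moricz2013I.integral_sub_integral s hint ht1.le htT.le, ← hJ, ← hJ, hJT, hJt,
      hlogT] at h1
    -- `h1 : s t (l Lt - Lt) ≤ τ T (l Lt) - τ t Lt + ε' (l Lt - Lt)`
    have hD : 0 < l * Lt - Lt := by nlinarith
    have hKD : K * (l * Lt - Lt) = l * Lt := by rw [hK]; field_simp
    have hτTt : |τ T - τ t| < 2 * δ := by
      have e : τ T - τ t = (τ T - A) - (τ t - A) := by ring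
      rw [e]
      refine (abs_sub _ _).trans_lt ?_
      linarith [hτA T (hτt.trans htT.le), hτA t hτt]
    have hτt' : τ t < A + δ := by linarith [(abs_lt.1 (hτA t hτt)).2]
    have hA1 : (τ T - τ t) * (l * Lt) ≤ |τ T - τ t| * (K * (l * Lt - Lt)) := by
      rw [hKD]
      exact mul_le_mul_of_nonneg_right (le_abs_self _) (by positivity)
    have h2 : s t * (l * Lt - Lt) ≤ (|τ T - τ t| * K + τ t + ε') * (l * Lt - Lt) := by
      linarith [h1, hA1]
    have h4 : s t ≤ |τ T - τ t| * K + τ t + ε' := le_of_mul_le_mul_right h2 hD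
    have h5 : |τ T - τ t| * K < 2 * δ * K := mul_lt_mul_of_pos_right hτTt hKpos
    linarith [h4, h5, hτt', hδK]
  ------------------------------------------------------------------
  -- LOWER BOUND via `T' = t ^ (1 / l)`
  ------------------------------------------------------------------
  have hlow : A - 2 * ε' < s t := by
    set T : ℝ := t ^ (1 / l) with hT
    have hMT : M ≤ T := by
      have h2 := Real.rpow_le_rpow (by positivity) ht (by positivity : (0 : ℝ) ≤ 1 / l)
      rw [one_div, Real.rpow_rpow_inv hM0 hlne] at h2
      rwa [hT, one_div]
    have hT1 : 1 < T := by linarith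
    have hTpos : 0 < T := by linarith
    have hTt : T ≤ t := by
      have := Real.rpow_le_rpow_of_exponent_le ht1.le ((div_le_one hl0).2 hl.le)
      rwa [Real.rpow_one] at this
    have hlogT : Real.log T = (1 / l) * Lt := by rw [hT, Real.log_rpow htpos]
    have hJT : J T = τ T * ((1 / l) * Lt) := by rw [hJτ T hT1, hlogT]
    -- slow decrease on `[T, t]` (roles of `t` and `u` exchanged)
    have hsd' : ∀ u ∈ Icc T t, -ε' ≤ s t - s u := by
      intro u hu
      rcases eq_or_lt_of_le hu.2 with h | h
      · rw [h]; simp [hε'pos.le]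
      · refine hslow u t (hMt₀.trans (hMT.trans hu.1)) h ?_
        have hu0 : 0 ≤ u := hTpos.le.trans hu.1
        have h2 := Real.rpow_le_rpow hTpos.le hu.1 hl0.le
        rwa [hT, one_div, Real.rpow_inv_rpow htpos.le hlne] at h2
    have h1 := Moricz2013I.integral_le s hint (s t) ε' hT1.le hTt hsd'
    rw [← Moricz2013I.integral_sub_integral s hint hT1.le hTt, ← hJ, ← hJ, hJT, hJt,
      hlogT] at h1
    -- `h1 : τ t Lt - τ T (Lt / l) - ε' (Lt - Lt/l) ≤ s t (Lt - Lt / l)`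
    have hD : 0 < Lt - 1 / l * Lt := by
      have : 1 / l < 1 := (div_lt_one hl0).2 hl
      nlinarith
    have hKD : K * (Lt - 1 / l * Lt) = Lt := by rw [hK]; field_simp
    have hKD' : 1 / l * Lt ≤ K * (Lt - 1 / l * Lt) := by
      rw [hKD]
      have : 1 / l ≤ 1 := (div_le_one hl0).2 hl.le
      nlinarith
    have hτtT : |τ t - τ T| < 2 * δ := by
      have e : τ t - τ T = (τ t - A) - (τ T - A) := by ring
      rw [e]
      refine (abs_sub _ _).trans_lt ?_
      linarith [hτA T (hMτ.trans hMT), hτA t hτt]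
    have hτt' : A - δ < τ t := by linarith [(abs_lt.1 (hτA t hτt)).1]
    have hA1 : -(|τ t - τ T| * (K * (Lt - 1 / l * Lt))) ≤ (τ t - τ T) * (1 / l * Lt) := by
      have h1' : -(|τ t - τ T| * (1 / l * Lt)) ≤ (τ t - τ T) * (1 / l * Lt) := by
        rw [← neg_mul]
        exact mul_le_mul_of_nonneg_right (neg_abs_le _) (by positivity)
      have h2' : |τ t - τ T| * (1 / l * Lt) ≤ |τ t - τ T| * (K * (Lt - 1 / l * Lt)) :=
        mul_le_mul_of_nonneg_left hKD' (abs_nonneg _)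
      linarith
    have h2 : (τ t - ε' - |τ t - τ T| * K) * (Lt - 1 / l * Lt) ≤ s t * (Lt - 1 / l * Lt) := by
      linarith [h1, hA1]
    have h4 : τ t - ε' - |τ t - τ T| * K ≤ s t := le_of_mul_le_mul_right h2 hD
    have h5 : |τ t - τ T| * K < 2 * δ * K := mul_lt_mul_of_pos_right hτtT hKpos
    linarith [h4, h5, hτt', hδK]
  -- conclusion
  rw [Real.dist_eq, abs_lt]
  constructor <;> linarith

end Moricz2013Cor1Proof

end Literature.Analysis.Asymptotics
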